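import Literature.Probability.LatticeModels.IsingPolarization
import HarnessLib

/-!
# The transverse-field Ising chain in Jordan–Wigner fermions: bilinear form, modes at the critical field, Fock polarization

Topic `Probability/LatticeModels`, namespace `Literature.Probability.LatticeModels`. Second file of
the exact computation of the critical diagonal correlations of the planar Ising model behind
`Literature.Probability.LatticeModels.wu_rhoCHI` (route: diagonal transfer matrix ↔ transverse-field
Ising chain, `DiagonalTransferMatrix`). The chain `H = -∑_i σᶻ_iσᶻ_{i+1} - h ∑_i σˣ_i` on the row
space `ℂ^{Row N}` is treated by the method of E. Lieb, T. Schultz, D. Mattis, Ann. Phys. **16**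
(1961) 407, §II (Jordan–Wigner transformation, running waves, Bogoliubov rotation; applied to this
chain by P. Pfeuty, Ann. Phys. **57** (1970) 79, §2), in the matrix language of the tree's
`IsingMajorana` / `IsingKaufman` / `IsingPolarization` (Kaufman's spinors `A_i, B_i` with
`σˣ_i = iA_iB_i`, `σᶻ_iσᶻ_{i+1} = iB_iA_{i+1}`, and the parity-twisted boundary bond):

* `tfiBil N h t` — the fermion BILINEAR `-∑_{i<N-1} iB_iA_{i+1} + t·iB_{N-1}A_0 - h∑_i iA_iB_i`;
  the real chain with boundary coupling `c = ±1` (`tfiHamTw N h c`, `c = -1`: one antiferromagnetic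
  bond) acts on the parity sector `P = s` (`P = ∏σˣ`) as `tfiBil N h (cs)`
  (`tfiHamTw_map_mulVec_of_parity`): the periodic chain is the ANTIPERIODIC bilinear `t = 1` on even
  vectors, and that same bilinear is the antiferromagnetically twisted chain on odd vectors
  (LSM 1961, §II.A, the "a-cyclic"/"c-cyclic" problem; SML 1964, §III);
* `tfiGen N h t` — its one-body generator: `[tfiBil, Γ(w)] = Γ(tfiGen w)` (`tfiBil_commutator_fieldOp`),
  from `[iΓ_aΓ_b, Γ(w)] = Γ(2i(w_b e_a - w_a e_b))` (`pairOp_commutator_fieldOp`);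
* at the CRITICAL field `h = 1` and `t = 1`: for every antiperiodic momentum (`e^{iqN} = -1`) the
  vectors `w_q = a_q - e^{iq/2} b_q` (`tfiLow`) and `w'_q = a_q + e^{iq/2} b_q` (`tfiHigh`) satisfy
  `tfiGen w_q = -ε_q w_q`, `tfiGen w'_q = +ε_q w'_q` with **`ε_q = 4 sin(q/2) > 0`** (Pfeuty's
  dispersion `Λ_q = 2√(1 + λ² - 2λ cos q)` at `λ = 1`): `Γ(w_q)` lowers and `Γ(w'_q)` raises the energy
  by `ε_q`, and there is no zero mode at finite `N` (`q_m = (2m+1)π/N ≠ 0`);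
* the **Fock polarization** `tfiPol N` (projection onto `span {w_{q_m}}` along `span {w'_{q_m}}`,
  through the inverse Fourier transform) with the two structural properties of
  `Literature.MathematicalPhysics.FreeFermions.IsPolarizedVacuum` (`tfiPol_mem`, `star_sub_tfiPol_mem`;
  `conj w'_{q_m} = w_{q_{N-1-m}}`), and its **contractions**: `2 (tfiPol e_{B_i})_{B_j} = δ_{ij}` and
  `2 (tfiPol e_{B_i})_{A_j} = -N⁻¹ ∑_m e^{iq_m(j-i)} e^{-iq_m/2}` (`two_mul_tfiPol_single_inr_inl`) —
  in closed form `-i/(N sin(π(2(j-i)-1)/(2N)))`, the finite-`N` kernel of the critical diagonal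
  Ising correlations (sequel files).

Everything is proved; definitions are explicit. That the Perron vector of the diagonal transfer
matrix is annihilated by the `Γ(w_{q_m})` is the next file.

## References

* E. Lieb, T. Schultz, D. Mattis, Ann. Phys. 16 (1961) 407–466, §II.
* P. Pfeuty, Ann. Phys. 57 (1970) 79–90, §2.
* T. D. Schultz, D. C. Mattis, E. H. Lieb, Rev. Mod. Phys. 36 (1964) 856–871, §§III–IV.
-/

noncomputable section

open Matrix Complex Finset Literature.MathematicalPhysics.FreeFermions

namespace Literature.Probability.LatticeModels

variable {N : ℕ}

/-! ### The commutator of a pair operator with a field -/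

section Commutator

variable {ι n : Type*} [Fintype ι] [DecidableEq ι] [Fintype n] [DecidableEq n] {Γ : ι → Matrix n n ℂ}

/-- **`[iΓ_aΓ_b, Γ(w)] = Γ(2i (w_b e_a - w_a e_b))`** for `a ≠ b`: the adjoint action of a fermion
bilinear on the fields is the infinitesimal plane rotation (LSM 1961, §II.B (the linear equations for the normal modes):
`[H, η] = -Λ η` as a linear problem on the coefficients). [cite: LiebSchultzMattisAP1961, §II.B] -/
theorem pairOp_commutator_fieldOp (hΓ : IsMajoranaFamily Γ) {a b : ι} (hab : a ≠ b) (w : ι → ℂ) :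
    pairOp Γ a b * fieldOp Γ w - fieldOp Γ w * pairOp Γ a b =
      fieldOp Γ ((2 * I * w b) • Pi.single a 1 - (2 * I * w a) • Pi.single b 1) := by
  have hL : pairOp Γ a b * fieldOp Γ w = ∑ c, w c • (pairOp Γ a b * Γ c) := by
    simp only [fieldOp, mul_sum, mul_smul_comm]
  have hR : fieldOp Γ w * pairOp Γ a b = ∑ c, w c • (Γ c * pairOp Γ a b) := by
    simp only [fieldOp, sum_mul, smul_mul_assoc]
  rw [hL, hR, sum_eq_add_add_sum_erase_erase hab, sum_eq_add_add_sum_erase_erase hab]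
  have hrest : ∑ c ∈ (univ.erase a).erase b, w c • (pairOp Γ a b * Γ c) =
      ∑ c ∈ (univ.erase a).erase b, w c • (Γ c * pairOp Γ a b) := by
    refine sum_congr rfl fun c hc => ?_
    have hcb : c ≠ b := (Finset.mem_erase.1 hc).1
    have hca : c ≠ a := (Finset.mem_erase.1 (Finset.mem_erase.1 hc).2).1
    rw [pairOp_mul_of_ne hΓ hca hcb]
  rw [hrest, pairOp_mul_left hΓ hab, left_mul_pairOp hΓ, pairOp_mul_right hΓ, right_mul_pairOp hΓ hab,
    fieldOp_sub, fieldOp_smul, fieldOp_smul, fieldOp_single, fieldOp_single]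
  simp only [smul_neg, smul_smul]
  module

end Commutator

/-! ### The transverse-field Ising chain as a fermion bilinear -/

section Bilinear

variable [NeZero N]

variable (N) in
/-- The boundary sign of the bilinear seen from bond `(i, i+1)`: `-t` on the boundary bond
`(N-1, 0)`, `1` in the bulk (for `t = 1` this is the tree's antiperiodic `twistAt N (-1)`). [folklore] -/
def twistC (t : ℂ) (i : Fin N) : ℂ := if (i : ℕ) + 1 = N then -t else 1

omit [NeZero N] in
/-- At `t = 1` the boundary sign is the antiperiodic twist `twistAt N (-1)`. [folklore] -/
theorem twistC_one (i : Fin N) : twistC N 1 i = (twistAt N (-1) i : ℂ) := by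
  unfold twistC twistAt
  split_ifs <;> norm_num

variable (N) in
/-- **The fermion bilinear of the transverse-field Ising chain** with boundary coefficient `t`:
`H_t = -∑_i τ_i · iB_iA_{i+1} - h ∑_i iA_iB_i`, `τ_i = 1` in the bulk and `τ_{N-1} = -t` on the
boundary bond (`σᶻ_iσᶻ_{i+1} = iB_iA_{i+1}` in the bulk, `σˣ_i = iA_iB_i`; `t = 1`: antiperiodic
fermions = the periodic chain on the even sector, LSM's "c-cyclic" problem). [cite: LiebSchultzMattisAP1961, §II.A] -/
def tfiBil (h : ℝ) (t : ℂ) : Matrix (Row N) (Row N) ℂ :=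
  -(∑ i, twistC N t i • pairOp (isingMajorana N) (Sum.inr i) (Sum.inl (i + 1))) -
    (h : ℂ) • ∑ i, pairOp (isingMajorana N) (Sum.inl i) (Sum.inr i)

variable (N) in
/-- **The one-body generator** of `H_t`: the map `w ↦ tfiGen w` on coefficient vectors with
`[H_t, Γ(w)] = Γ(tfiGen w)`; explicitly `(tfiGen w)_{A_j} = 2i (τ_{j-1} w_{B_{j-1}} - h w_{B_j})`,
`(tfiGen w)_{B_i} = -2i (τ_i w_{A_{i+1}} - h w_{A_i})` with the boundary sign `τ = twistC N t`
(LSM 1961, §II.B). [cite: LiebSchultzMattisAP1961, §II.B (the linear equations for the normal modes)] -/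
def tfiGen (h : ℝ) (t : ℂ) (w : Fin N ⊕ Fin N → ℂ) : Fin N ⊕ Fin N → ℂ :=
  Sum.elim (fun j => 2 * I * (twistC N t (j - 1) * w (Sum.inr (j - 1)) - (h : ℂ) * w (Sum.inr j)))
    (fun i => -(2 * I) * (twistC N t i * w (Sum.inl (i + 1)) - (h : ℂ) * w (Sum.inl i)))

/-- `tfiGen` at `A_j`. [folklore] -/
@[simp] theorem tfiGen_inl (h : ℝ) (t : ℂ) (w : Fin N ⊕ Fin N → ℂ) (j : Fin N) :
    tfiGen N h t w (Sum.inl j) = 2 * I * (twistC N t (j - 1) * w (Sum.inr (j - 1)) - (h : ℂ) * w (Sum.inr j)) := rfl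

/-- `tfiGen` at `B_i`. [folklore] -/
@[simp] theorem tfiGen_inr (h : ℝ) (t : ℂ) (w : Fin N ⊕ Fin N → ℂ) (i : Fin N) :
    tfiGen N h t w (Sum.inr i) = -(2 * I) * (twistC N t i * w (Sum.inl (i + 1)) - (h : ℂ) * w (Sum.inl i)) := rfl

/-- `tfiGen` is additive. [folklore] -/
theorem tfiGen_add (h : ℝ) (t : ℂ) (w w' : Fin N ⊕ Fin N → ℂ) :
    tfiGen N h t (w + w') = tfiGen N h t w + tfiGen N h t w' := by
  funext c; rcases c with j | i <;> simp <;> ring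

/-- `tfiGen` is homogeneous. [folklore] -/
theorem tfiGen_smul (h : ℝ) (t : ℂ) (c : ℂ) (w : Fin N ⊕ Fin N → ℂ) :
    tfiGen N h t (c • w) = c • tfiGen N h t w := by
  funext x; rcases x with j | i <;> simp <;> ring

omit [NeZero N] in
/-- `B_i ≠ A_j` as indices. [folklore] -/
theorem inr_ne_inl (i j : Fin N) : (Sum.inr i : Fin N ⊕ Fin N) ≠ Sum.inl j := Sum.inr_ne_inl

/-- The commutator of one Ising bond bilinear `iB_iA_{i+1}` with a field. [folklore] -/
theorem bondPair_commutator (w : Fin N ⊕ Fin N → ℂ) (i : Fin N) :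
    pairOp (isingMajorana N) (Sum.inr i) (Sum.inl (i + 1)) * fieldOp (isingMajorana N) w -
        fieldOp (isingMajorana N) w * pairOp (isingMajorana N) (Sum.inr i) (Sum.inl (i + 1)) =
      fieldOp (isingMajorana N) ((2 * I * w (Sum.inl (i + 1))) • Pi.single (Sum.inr i) 1 -
        (2 * I * w (Sum.inr i)) • Pi.single (Sum.inl (i + 1)) 1) :=
  pairOp_commutator_fieldOp (isMajoranaFamily_isingMajorana N) (inr_ne_inl i (i + 1)) w

omit [NeZero N] in
/-- The commutator of one transverse-field bilinear `iA_iB_i` with a field. [folklore] -/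
theorem fieldPair_commutator (w : Fin N ⊕ Fin N → ℂ) (i : Fin N) :
    pairOp (isingMajorana N) (Sum.inl i) (Sum.inr i) * fieldOp (isingMajorana N) w -
        fieldOp (isingMajorana N) w * pairOp (isingMajorana N) (Sum.inl i) (Sum.inr i) =
      fieldOp (isingMajorana N) ((2 * I * w (Sum.inr i)) • Pi.single (Sum.inl i) 1 -
        (2 * I * w (Sum.inl i)) • Pi.single (Sum.inr i) 1) :=
  pairOp_commutator_fieldOp (isMajoranaFamily_isingMajorana N) (Ne.symm (inr_ne_inl i i)) w

omit [NeZero N] in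
/-- Commutators are additive in the operator: `[∑_k X_k, F] = ∑_k [X_k, F]`. [folklore] -/
theorem sum_mul_sub_mul_sum {κ : Type*} (s : Finset κ) (X : κ → Matrix (Row N) (Row N) ℂ)
    (F : Matrix (Row N) (Row N) ℂ) :
    (∑ k ∈ s, X k) * F - F * ∑ k ∈ s, X k = ∑ k ∈ s, (X k * F - F * X k) := by
  rw [sum_mul, mul_sum, ← sum_sub_distrib]

/-- The coefficient vector of `[H_t, Γ(w)]` assembled from the bond commutators is `tfiGen w`. [folklore] -/
theorem tfiGen_eq_sum (h : ℝ) (t : ℂ) (w : Fin N ⊕ Fin N → ℂ) :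
    tfiGen N h t w =
      -(∑ i, twistC N t i • ((2 * I * w (Sum.inl (i + 1))) • Pi.single (Sum.inr i) 1 -
          (2 * I * w (Sum.inr i)) • Pi.single (Sum.inl (i + 1)) 1)) -
      (h : ℂ) • ∑ i, ((2 * I * w (Sum.inr i)) • Pi.single (Sum.inl i) 1 -
          (2 * I * w (Sum.inl i)) • Pi.single (Sum.inr i) 1) := by
  funext c
  simp only [Pi.sub_apply, Pi.neg_apply, Pi.smul_apply, Finset.sum_apply, Pi.single_apply,
    smul_eq_mul, mul_ite, mul_one, mul_zero, Finset.sum_sub_distrib, mul_sub]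
  rcases c with j | i
  · -- the `A_j` component: only the bond `(j-1, j)` and the field at `j` contribute
    have e1 : ∀ i : Fin N, ((Sum.inl j : Fin N ⊕ Fin N) = Sum.inr i) = False := fun i => by simp
    have e2 : ∀ i : Fin N, ((Sum.inl j : Fin N ⊕ Fin N) = Sum.inl (i + 1)) = (i = j - 1) := fun i => by
      rw [Sum.inl.injEq]; exact propext ⟨fun e => by rw [e, add_sub_cancel_right], fun e => by rw [e, sub_add_cancel]⟩
    have e3 : ∀ i : Fin N, ((Sum.inl j : Fin N ⊕ Fin N) = Sum.inl i) = (i = j) := fun i => by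
      rw [Sum.inl.injEq]; exact propext eq_comm
    simp only [e1, e2, e3, if_false, Finset.sum_const_zero, Finset.sum_ite_eq', Finset.mem_univ, if_true,
      zero_sub, tfiGen_inl]
    ring
  · -- the `B_i` component: only the bond `(i, i+1)` and the field at `i` contribute
    have e1 : ∀ j : Fin N, ((Sum.inr i : Fin N ⊕ Fin N) = Sum.inl j) = False := fun j => by simp
    have e3 : ∀ j : Fin N, ((Sum.inr i : Fin N ⊕ Fin N) = Sum.inr j) = (j = i) := fun j => by
      rw [Sum.inr.injEq]; exact propext eq_comm
    simp only [e1, e3, if_false, Finset.sum_const_zero, Finset.sum_ite_eq', Finset.mem_univ, if_true,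
      sub_zero, tfiGen_inr]
    ring

/-- **`[H_t, Γ(w)] = Γ(tfiGen w)`**: the bilinear acts on the fields through its one-body generator
(LSM 1961, §II.B). [cite: LiebSchultzMattisAP1961, §II.B (the linear equations for the normal modes)] -/
theorem tfiBil_commutator_fieldOp (h : ℝ) (t : ℂ) (w : Fin N ⊕ Fin N → ℂ) :
    tfiBil N h t * fieldOp (isingMajorana N) w - fieldOp (isingMajorana N) w * tfiBil N h t =
      fieldOp (isingMajorana N) (tfiGen N h t w) := by
  set F := fieldOp (isingMajorana N) w with hF
  set S := ∑ i, twistC N t i • pairOp (isingMajorana N) (Sum.inr i) (Sum.inl (i + 1)) with hS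
  set T := ∑ i, pairOp (isingMajorana N) (Sum.inl i) (Sum.inr i) with hT
  have h1 : S * F - F * S = fieldOp (isingMajorana N)
      (∑ i, twistC N t i • ((2 * I * w (Sum.inl (i + 1))) • Pi.single (Sum.inr i) 1 -
          (2 * I * w (Sum.inr i)) • Pi.single (Sum.inl (i + 1)) 1)) := by
    rw [hS, sum_mul_sub_mul_sum, fieldOp_sum]
    refine sum_congr rfl fun i _ => ?_
    rw [fieldOp_smul, ← bondPair_commutator, smul_sub, smul_mul_assoc, mul_smul_comm]
  have h2 : T * F - F * T = fieldOp (isingMajorana N)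
      (∑ i, ((2 * I * w (Sum.inr i)) • Pi.single (Sum.inl i) 1 - (2 * I * w (Sum.inl i)) • Pi.single (Sum.inr i) 1)) := by
    rw [hT, sum_mul_sub_mul_sum, fieldOp_sum]
    exact sum_congr rfl fun i _ => fieldPair_commutator w i
  rw [tfiGen_eq_sum, fieldOp_sub, fieldOp_neg, fieldOp_smul, ← h1, ← h2]
  change (-S - (h : ℂ) • T) * F - F * (-S - (h : ℂ) • T) = -(S * F - F * S) - (h : ℂ) • (T * F - F * T)
  simp only [sub_mul, mul_sub, neg_mul, mul_neg, smul_mul_assoc, mul_smul_comm, smul_sub]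
  abel

end Bilinear

/-! ### The real chain with a twisted boundary bond, and its action on the parity sectors -/

section Parity

variable [NeZero N]

variable (N) in
/-- The transverse-field Ising chain with the boundary bond coupling multiplied by `c`:
`H_c = -(∑_{i<N-1} σᶻ_iσᶻ_{i+1} + c σᶻ_{N-1}σᶻ_0) - h ∑_i σˣ_i` as a real symmetric matrix on
`ℝ^{Row N}` (`c = 1`: the periodic chain; `c = -1`: one antiferromagnetic bond). [cite: PfeutyAnnPhys1970, §1 (the Hamiltonian)] -/
def tfiHamTw (h c : ℝ) : Matrix (Row N) (Row N) ℝ := -Matrix.diagonal (rowEnergyTw N c) - h • ∑ i, sigmaX i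

/-- A weighted sum of the bonds `σᶻ_iσᶻ_{i+1}` is the diagonal matrix of the weighted energies. [folklore] -/
theorem sum_smul_sigmaZC_mul_sigmaZC (c : Fin N → ℝ) :
    ∑ i, (c i : ℂ) • (sigmaZC i * sigmaZC (i + 1)) =
      diagonal fun r : Row N => (((∑ i, c i * (spinAt i r * spinAt (i + 1) r) : ℝ)) : ℂ) := by
  ext r r'
  simp only [Matrix.sum_apply, Matrix.smul_apply, sigmaZC_mul_sigmaZC_eq_diagonal, diagonal_apply, smul_eq_mul,
    mul_ite, mul_zero, Complex.ofReal_sum, Complex.ofReal_mul]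
  split_ifs
  · rfl
  · simp

/-- **The complexified twisted chain in spin operators**:
`(H_c)_ℂ = -∑_i τ^c_i σᶻ_iσᶻ_{i+1} - h ∑_i σˣ_i`, `τ^c = twistAt N c`. [folklore] -/
theorem tfiHamTw_map (h c : ℝ) :
    (tfiHamTw N h c).map (algebraMap ℝ ℂ) =
      -(∑ i, (twistAt N c i : ℂ) • (sigmaZC i * sigmaZC (i + 1))) - (h : ℂ) • ∑ i, sigmaXC (N := N) i := by
  rw [sum_smul_sigmaZC_mul_sigmaZC]
  ext r r'
  simp only [tfiHamTw, rowEnergyTw, Matrix.map_apply, Matrix.sub_apply, Matrix.neg_apply, Matrix.smul_apply,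
    Matrix.sum_apply, diagonal_apply, sigmaXC_eq_map, Complex.coe_algebraMap, smul_eq_mul, Complex.ofReal_sub,
    Complex.ofReal_neg, Complex.ofReal_mul, Complex.ofReal_sum, apply_ite Complex.ofReal, Complex.ofReal_zero]

/-- **The twisted chain on a parity sector is the bilinear**: if `P v = s v` with `s = ±1` and
`c = ±1`, then `(H_c)_ℂ v = H_{t} v` with boundary coefficient `t = cs` (the parity eigenvalue and
the boundary coupling combine: `σᶻ_{N-1}σᶻ_0 = -P · iB_{N-1}A_0`). In particular the periodic chain
(`c = 1`) acts on EVEN vectors as the antiperiodic bilinear `tfiBil N h 1`, and `tfiBil N h 1` acts on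
ODD vectors as the chain with an antiferromagnetic boundary bond (`c = -1`) (LSM 1961, §II.A:
"c-cyclic" vs "a-cyclic"; SML 1964, §III). [cite: LiebSchultzMattisAP1961, §II.A] -/
theorem tfiHamTw_map_mulVec_of_parity (h : ℝ) {c s : ℝ} {v : Row N → ℂ}
    (hv : jwString (univ : Finset (Fin N)) *ᵥ v = (s : ℂ) • v) :
    (tfiHamTw N h c).map (algebraMap ℝ ℂ) *ᵥ v = tfiBil N h ((c * s : ℝ) : ℂ) *ᵥ v := by
  rw [tfiHamTw_map, tfiBil]
  simp only [sub_mulVec, neg_mulVec, smul_mulVec, sum_mulVec]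
  congr 2
  · refine Finset.sum_congr rfl fun i _ => ?_
    by_cases hi : (i : ℕ) + 1 = N
    · -- the boundary bond: `σᶻσᶻ = -P K`, `P v = s v`
      have hPK : jwString (univ : Finset (Fin N)) * pairOp (isingMajorana N) (Sum.inr i) (Sum.inl (i + 1)) =
          pairOp (isingMajorana N) (Sum.inr i) (Sum.inl (i + 1)) * jwString univ := jwString_univ_mul_pairOp _ _
      rw [sigmaZC_mul_sigmaZC_last i hi, twistC, twistAt, if_pos hi, if_pos hi, hPK, neg_mulVec, ← mulVec_mulVec, hv,
        mulVec_smul]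
      simp only [smul_neg, smul_smul, neg_smul, Complex.ofReal_mul]
    · rw [twistC, twistAt, if_neg hi, if_neg hi, pairOp_ePlane_of_ne_last hi, Complex.ofReal_one]
  · refine Finset.sum_congr rfl fun i _ => ?_
    rw [pairOp_inl_inr]

/-- The untwisted case `c = 1`: the periodic chain acts on the sector `P = s` as `tfiBil N h s`. [cite: LiebSchultzMattisAP1961, §II.A] -/
theorem tfiHamTw_one_map_mulVec_of_parity (h : ℝ) {s : ℝ} {v : Row N → ℂ}
    (hv : jwString (univ : Finset (Fin N)) *ᵥ v = (s : ℂ) • v) :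
    (tfiHamTw N h 1).map (algebraMap ℝ ℂ) *ᵥ v = tfiBil N h (s : ℂ) *ᵥ v := by
  rw [tfiHamTw_map_mulVec_of_parity h hv, one_mul]

/-- The antiperiodic bilinear on ODD vectors is the antiferromagnetically twisted chain:
`P v = -v ⇒ tfiBil N h 1 v = (H_{-1})_ℂ v`. [cite: LiebSchultzMattisAP1961, §II.A] -/
theorem tfiBil_one_mulVec_of_odd (h : ℝ) {v : Row N → ℂ}
    (hv : jwString (univ : Finset (Fin N)) *ᵥ v = ((-1 : ℝ) : ℂ) • v) :
    tfiBil N h 1 *ᵥ v = (tfiHamTw N h (-1)).map (algebraMap ℝ ℂ) *ᵥ v := by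
  rw [tfiHamTw_map_mulVec_of_parity h hv]
  norm_num

/-- `H_c` is symmetric. [folklore] -/
theorem tfiHamTw_isHermitian (h c : ℝ) : (tfiHamTw N h c).IsHermitian := by
  have hX : ∀ i : Fin N, (sigmaX (N := N) i).IsHermitian := fun i => by
    rw [Matrix.IsHermitian, conjTranspose_eq_transpose_of_trivial]
    ext r r'
    rw [transpose_apply, sigmaX_apply_comm]
  have hF : (∑ i, sigmaX (N := N) i).IsHermitian := by
    rw [Matrix.IsHermitian, Matrix.conjTranspose_sum]
    exact Finset.sum_congr rfl fun i _ => hX i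
  have hD : (Matrix.diagonal (rowEnergyTw N c)).IsHermitian := by
    rw [Matrix.IsHermitian, diagonal_conjTranspose]
    rfl
  have hsm : (h • ∑ i, sigmaX (N := N) i).IsHermitian := by
    rw [Matrix.IsHermitian, conjTranspose_smul, hF.eq]
    rfl
  unfold tfiHamTw
  exact hD.neg.sub hsm

end Parity

/-! ### The modes at the critical field `h = 1` -/

section Modes

variable [NeZero N]

/-- The half phase `e^{iq/2}`. [folklore] -/
def halfPh (q : ℝ) : ℂ := Complex.exp (q / 2 * I)

omit [NeZero N] in
/-- `e^{iq/2} e^{iq/2} = e^{iq}`. [folklore] -/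
theorem halfPh_mul_self (q : ℝ) : halfPh q * halfPh q = Complex.exp (q * I) := by
  rw [halfPh, ← Complex.exp_add]
  congr 1
  ring

omit [NeZero N] in
/-- `e^{iq/2} e^{-iq} = e^{-iq/2}`, written as `halfPh q * e^{-iq} * halfPh q = 1`. [folklore] -/
theorem halfPh_mul_exp_neg_mul_halfPh (q : ℝ) : halfPh q * Complex.exp (-(q * I)) * halfPh q = 1 := by
  rw [halfPh, ← Complex.exp_add, ← Complex.exp_add, ← Complex.exp_zero]
  congr 1
  ring

omit [NeZero N] in
/-- `e^{iq/2} - e^{-iq/2} = 2i sin(q/2)`, in the form `e^{iq} - 1 = 2i sin(q/2) e^{iq/2}`. [folklore] -/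
theorem exp_mul_I_sub_one (q : ℝ) :
    Complex.exp (q * I) - 1 = 2 * I * ((Real.sin (q / 2) : ℝ) : ℂ) * halfPh q := by
  have h1 : Complex.exp (q * I) = halfPh q * halfPh q := (halfPh_mul_self q).symm
  have h2 : halfPh q * Complex.exp (-((q / 2 : ℝ) : ℂ) * I) = 1 := by
    rw [halfPh, ← Complex.exp_add, ← Complex.exp_zero]
    congr 1
    push_cast
    ring
  have hs : ((Real.sin (q / 2) : ℝ) : ℂ) = Complex.sin ((q / 2 : ℝ) : ℂ) := Complex.ofReal_sin _
  rw [hs, Complex.sin, h1]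
  have h3 : Complex.exp (((q / 2 : ℝ) : ℂ) * I) = halfPh q := by rw [halfPh]; push_cast; ring_nf
  rw [h3]
  linear_combination h2 - ((Complex.exp (-((q / 2 : ℝ) : ℂ) * I) - halfPh q) * halfPh q) * Complex.I_mul_I

omit [NeZero N] in
/-- `1 - e^{-iq} = 2i sin(q/2) e^{-iq/2}`, in the form `halfPh q (1 - e^{-iq}) = 2i sin(q/2)`. [folklore] -/
theorem halfPh_mul_one_sub_exp_neg (q : ℝ) :
    halfPh q * (1 - Complex.exp (-(q * I))) = 2 * I * ((Real.sin (q / 2) : ℝ) : ℂ) := by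
  have h := exp_mul_I_sub_one q
  have h2 := halfPh_mul_exp_neg_mul_halfPh q
  have h3 := halfPh_mul_self q
  -- multiply `e^{iq} - 1 = 2i sin(q/2) e^{iq/2}` by `e^{-iq} e^{iq/2}` and use `e^{iq/2} e^{-iq} e^{iq/2} = 1`
  linear_combination (Complex.exp (-(q * I)) * halfPh q) * h +
    (2 * I * ((Real.sin (q / 2) : ℝ) : ℂ) - halfPh q) * h2 + (Complex.exp (-(q * I)) * halfPh q) * h3

variable (N) in
/-- **The lowering vector** at momentum `q` for the critical chain (`h = 1`, antiperiodic):
`w_q = a_q - e^{iq/2} b_q`, i.e. `Γ(w_q) = ∑_j e^{iqj} (A_j - e^{iq/2} B_j)` (Pfeuty 1970, §2, the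
Bogoliubov rotation at `λ = 1`, where the angle is `q/2`-linear). [cite: PfeutyAnnPhys1970, §2 (exact solution by the LSM method)] -/
def tfiLow (q : ℝ) : Fin N ⊕ Fin N → ℂ := aVec N q - halfPh q • bVec N q

variable (N) in
/-- **The raising vector** at momentum `q`: `w'_q = a_q + e^{iq/2} b_q`. [cite: PfeutyAnnPhys1970, §2 (exact solution by the LSM method)] -/
def tfiHigh (q : ℝ) : Fin N ⊕ Fin N → ℂ := aVec N q + halfPh q • bVec N q

omit [NeZero N] in
/-- `w_q(A_j) = e^{iqj}`. [folklore] -/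
@[simp] theorem tfiLow_inl (q : ℝ) (j : Fin N) : tfiLow N q (Sum.inl j) = ph q j := by simp [tfiLow]
omit [NeZero N] in
/-- `w_q(B_j) = -e^{iq/2} e^{iqj}`. [folklore] -/
@[simp] theorem tfiLow_inr (q : ℝ) (j : Fin N) : tfiLow N q (Sum.inr j) = -(halfPh q * ph q j) := by simp [tfiLow]
omit [NeZero N] in
/-- `w'_q(A_j) = e^{iqj}`. [folklore] -/
@[simp] theorem tfiHigh_inl (q : ℝ) (j : Fin N) : tfiHigh N q (Sum.inl j) = ph q j := by simp [tfiHigh]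
omit [NeZero N] in
/-- `w'_q(B_j) = e^{iq/2} e^{iqj}`. [folklore] -/
@[simp] theorem tfiHigh_inr (q : ℝ) (j : Fin N) : tfiHigh N q (Sum.inr j) = halfPh q * ph q j := by simp [tfiHigh]

omit [NeZero N] in
/-- **Pfeuty's critical dispersion** `ε_q = 4 sin(q/2)` (`= 2√(2 - 2cos q)`, the `λ = 1` case of
`Λ_q = 2√(1 + λ² - 2λ cos q)` in units `J = 1`, `Γ = λ`; Pfeuty 1970). [cite: PfeutyAnnPhys1970, §2 (the spectrum Λ_k)] -/
def tfiEps (q : ℝ) : ℝ := 4 * Real.sin (q / 2)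

/-- `ε_{q_m} > 0` for every antiperiodic momentum: no zero mode at finite `N`. [folklore] -/
theorem tfiEps_apMom_pos (m : Fin N) : 0 < tfiEps (apMom N m) := by
  unfold tfiEps
  have h1 : 0 < apMom N m / 2 := by linarith [apMom_pos m]
  have h2 : apMom N m / 2 < Real.pi := by linarith [apMom_lt_two_pi m]
  have := Real.sin_pos_of_pos_of_lt_pi h1 h2
  linarith

/-- The shifted wave downwards: `τ_{j-1} e^{iq(j-1)} = e^{-iq} e^{iqj}` for antiperiodic `q`. [folklore] -/
theorem twistC_one_mul_ph_sub_one {q : ℝ} (hq : Complex.exp (q * N * I) = -1) (j : Fin N) :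
    twistC N 1 (j - 1) * ph q ((j - 1 : Fin N) : ℕ) = Complex.exp (-(q * I)) * ph q j := by
  rw [twistC_one, twist_mul_ph hq (j - 1), sub_add_cancel]

/-- The shifted wave upwards: `τ_i e^{iq(i+1)} = e^{iq} e^{iqi}` for antiperiodic `q`. [folklore] -/
theorem twistC_one_mul_ph_add_one {q : ℝ} (hq : Complex.exp (q * N * I) = -1) (i : Fin N) :
    twistC N 1 i * ph q ((i + 1 : Fin N) : ℕ) = Complex.exp (q * I) * ph q i := by
  rw [twistC_one, twist_mul_ph_succ hq i]

/-- **`Γ(w_q)` lowers the energy by `ε_q`**: `tfiGen w_q = -ε_q w_q` for the critical antiperiodic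
bilinear (`h = 1`, `t = 1`) and `e^{iqN} = -1` (LSM 1961, §II.B; Pfeuty 1970). [cite: PfeutyAnnPhys1970, §2 (exact solution, dispersion Λ_k; λ = 1)] -/
theorem tfiGen_tfiLow {q : ℝ} (hq : Complex.exp (q * N * I) = -1) :
    tfiGen N 1 1 (tfiLow N q) = -((tfiEps q : ℝ) : ℂ) • tfiLow N q := by
  have hs := halfPh_mul_one_sub_exp_neg q
  have he := exp_mul_I_sub_one q
  have hε : ((tfiEps q : ℝ) : ℂ) = 4 * ((Real.sin (q / 2) : ℝ) : ℂ) := by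
    rw [tfiEps, Complex.ofReal_mul, Complex.ofReal_ofNat]
  funext c
  rcases c with j | i
  · rw [tfiGen_inl, Pi.smul_apply, tfiLow_inl, tfiLow_inr, tfiLow_inr, smul_eq_mul, mul_neg, mul_left_comm,
      twistC_one_mul_ph_sub_one hq j, hε, Complex.ofReal_one]
    linear_combination (2 * I * ph q j) * hs + (4 * ((Real.sin (q / 2) : ℝ) : ℂ) * ph q j) * Complex.I_mul_I
  · rw [tfiGen_inr, Pi.smul_apply, tfiLow_inl, tfiLow_inl, tfiLow_inr, smul_eq_mul, twistC_one_mul_ph_add_one hq i, hε,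
      Complex.ofReal_one]
    linear_combination (-2 * I * ph q i) * he +
      (-4 * ((Real.sin (q / 2) : ℝ) : ℂ) * halfPh q * ph q i) * Complex.I_mul_I

/-- **`Γ(w'_q)` raises the energy by `ε_q`**: `tfiGen w'_q = +ε_q w'_q`. [cite: PfeutyAnnPhys1970, §2 (exact solution, dispersion Λ_k; λ = 1)] -/
theorem tfiGen_tfiHigh {q : ℝ} (hq : Complex.exp (q * N * I) = -1) :
    tfiGen N 1 1 (tfiHigh N q) = ((tfiEps q : ℝ) : ℂ) • tfiHigh N q := by
  have hs := halfPh_mul_one_sub_exp_neg q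
  have he := exp_mul_I_sub_one q
  have hε : ((tfiEps q : ℝ) : ℂ) = 4 * ((Real.sin (q / 2) : ℝ) : ℂ) := by
    rw [tfiEps, Complex.ofReal_mul, Complex.ofReal_ofNat]
  funext c
  rcases c with j | i
  · rw [tfiGen_inl, Pi.smul_apply, tfiHigh_inl, tfiHigh_inr, tfiHigh_inr, smul_eq_mul, mul_left_comm,
      twistC_one_mul_ph_sub_one hq j, hε, Complex.ofReal_one]
    linear_combination (-2 * I * ph q j) * hs + (-4 * ((Real.sin (q / 2) : ℝ) : ℂ) * ph q j) * Complex.I_mul_I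
  · rw [tfiGen_inr, Pi.smul_apply, tfiHigh_inl, tfiHigh_inl, tfiHigh_inr, smul_eq_mul, twistC_one_mul_ph_add_one hq i,
      hε, Complex.ofReal_one]
    linear_combination (-2 * I * ph q i) * he +
      (-4 * ((Real.sin (q / 2) : ℝ) : ℂ) * halfPh q * ph q i) * Complex.I_mul_I

/-- `conj e^{iq/2} = e^{-iq/2}` and `e^{i(2π-q)/2} = -e^{-iq/2}`: `halfPh (2π - q) = -conj (halfPh q)`. [folklore] -/
theorem halfPh_two_pi_sub (q : ℝ) : halfPh (2 * Real.pi - q) = -starRingEnd ℂ (halfPh q) := by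
  have hz : starRingEnd ℂ ((q : ℂ) / 2) = (q : ℂ) / 2 := by
    rw [map_div₀, Complex.conj_ofReal, map_ofNat]
  rw [halfPh, halfPh, conj_exp_mul_I hz]
  have h : ((2 * Real.pi - q : ℝ) : ℂ) / 2 * I = -((q : ℂ) / 2 * I) + Real.pi * I := by push_cast; ring
  rw [h, Complex.exp_add, Complex.exp_pi_mul_I, mul_neg_one]

/-- **`conj w'_{q_m} = w_{q_{N-1-m}}`**: the conjugates of the raising vectors are the lowering
vectors (with `q_{N-1-m} = 2π - q_m`). [folklore] -/
theorem star_tfiHigh_apMom (m : Fin N) : star (tfiHigh N (apMom N m)) = tfiLow N (apMom N (Fin.rev m)) := by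
  rw [tfiHigh, tfiLow, star_add, star_smul, star_aVec, star_bVec, apMom_rev, aVec_two_pi_sub, bVec_two_pi_sub,
    halfPh_two_pi_sub, Complex.star_def, neg_smul, sub_neg_eq_add]

end Modes

/-! ### The Fock polarization of the critical chain -/

section Polarization

/-- `e^{iq/2} ≠ 0`. [folklore] -/
theorem halfPh_ne_zero (q : ℝ) : halfPh q ≠ 0 := Complex.exp_ne_zero _

variable (N) in
/-- The `A → B` kernel of the polarization:
`(P e_{A_j})_{B_k} = -N⁻¹ ∑_m e^{-iq_mj} e^{iq_mk} e^{iq_m/2}/2`. [cite: LiebSchultzMattisAP1961, §II.C (the contractions G_{ij})] -/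
def tfiKerA (j k : Fin N) : ℂ :=
  (N : ℂ)⁻¹ * ∑ m : Fin N, starRingEnd ℂ (ph (apMom N m) j) * ph (apMom N m) k * (-halfPh (apMom N m) / 2)

variable (N) in
/-- The `B → A` kernel of the polarization:
`(P e_{B_j})_{A_k} = -N⁻¹ ∑_m e^{-iq_mj} e^{iq_mk} e^{-iq_m/2}/2`. [cite: LiebSchultzMattisAP1961, §II.C (the contractions G_{ij})] -/
def tfiKerB (j k : Fin N) : ℂ :=
  (N : ℂ)⁻¹ * ∑ m : Fin N, starRingEnd ℂ (ph (apMom N m) j) * ph (apMom N m) k * (-(halfPh (apMom N m))⁻¹ / 2)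

variable (N) in
/-- The matrix of the polarization (column `c` = `P e_c`). [cite: LiebSchultzMattisAP1961, §II.C] -/
def tfiPolMat : Matrix (Fin N ⊕ Fin N) (Fin N ⊕ Fin N) ℂ :=
  Matrix.fromBlocks ((1 / 2 : ℂ) • (1 : Matrix (Fin N) (Fin N) ℂ)) (Matrix.of fun k j => tfiKerB N j k)
    (Matrix.of fun k j => tfiKerA N j k) ((1 / 2 : ℂ) • (1 : Matrix (Fin N) (Fin N) ℂ))

variable (N) in
/-- **The Fock polarization of the critical transverse-field Ising chain**: the projection of the
coefficient space `ℂ^{2N}` onto the span of the lowering vectors `w_{q_m}` along the span of the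
raising vectors `w'_{q_m}`, in coordinates (LSM 1961, §II.C; Pfeuty 1970, §2). [cite: LiebSchultzMattisAP1961, §II.C] -/
def tfiPol : (Fin N ⊕ Fin N → ℂ) →ₗ[ℂ] (Fin N ⊕ Fin N → ℂ) := (tfiPolMat N).mulVecLin

/-- `P e_c` is the column `c` of the matrix. [folklore] -/
theorem tfiPol_single_apply (c c' : Fin N ⊕ Fin N) : tfiPol N (Pi.single c 1) c' = tfiPolMat N c' c := by
  rw [tfiPol, Matrix.mulVecLin_apply, mulVec_single_one]
  rfl

/-- `(P e_{A_j})_{A_k} = δ_{jk}/2`. [folklore] -/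
theorem tfiPol_single_inl_inl (j k : Fin N) :
    tfiPol N (Pi.single (Sum.inl j) 1) (Sum.inl k) = if j = k then 1 / 2 else 0 := by
  rw [tfiPol_single_apply, tfiPolMat, fromBlocks_apply₁₁, Matrix.smul_apply, Matrix.one_apply, smul_eq_mul, mul_ite,
    mul_one, mul_zero]
  simp only [eq_comm]

/-- `(P e_{A_j})_{B_k} = tfiKerA j k`. [folklore] -/
theorem tfiPol_single_inl_inr (j k : Fin N) :
    tfiPol N (Pi.single (Sum.inl j) 1) (Sum.inr k) = tfiKerA N j k := by
  rw [tfiPol_single_apply, tfiPolMat, fromBlocks_apply₂₁, Matrix.of_apply]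

/-- `(P e_{B_j})_{A_k} = tfiKerB j k`. [folklore] -/
theorem tfiPol_single_inr_inl (j k : Fin N) :
    tfiPol N (Pi.single (Sum.inr j) 1) (Sum.inl k) = tfiKerB N j k := by
  rw [tfiPol_single_apply, tfiPolMat, fromBlocks_apply₁₂, Matrix.of_apply]

/-- `(P e_{B_j})_{B_k} = δ_{jk}/2`. [folklore] -/
theorem tfiPol_single_inr_inr (j k : Fin N) :
    tfiPol N (Pi.single (Sum.inr j) 1) (Sum.inr k) = if j = k then 1 / 2 else 0 := by
  rw [tfiPol_single_apply, tfiPolMat, fromBlocks_apply₂₂, Matrix.smul_apply, Matrix.one_apply, smul_eq_mul, mul_ite,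
    mul_one, mul_zero]
  simp only [eq_comm]

variable [NeZero N]

/-- **`P e_{A_j}` is a combination of lowering vectors**: `P e_{A_j} = ∑_m e^{-iq_mj}/(2N) · w_{q_m}`
(inverse Fourier transform and `a_q = (w_q + w'_q)/2`). [cite: LiebSchultzMattisAP1961, §II.C] -/
theorem tfiPol_single_inl (j : Fin N) :
    tfiPol N (Pi.single (Sum.inl j) 1) =
      ∑ m : Fin N, (starRingEnd ℂ (ph (apMom N m) j) / (2 * N)) • tfiLow N (apMom N m) := by
  have hN : (N : ℂ) ≠ 0 := Nat.cast_ne_zero.2 (NeZero.ne N)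
  funext c
  rw [Finset.sum_apply]
  rcases c with k | k
  · rw [tfiPol_single_inl_inl, ← sum_conj_ph_mul_ph_div]
    refine sum_congr rfl fun m _ => ?_
    simp only [Pi.smul_apply, smul_eq_mul, tfiLow_inl]
    ring
  · rw [tfiPol_single_inl_inr, tfiKerA, mul_sum]
    refine sum_congr rfl fun m _ => ?_
    simp only [Pi.smul_apply, smul_eq_mul, tfiLow_inr]
    field_simp

/-- **`P e_{B_j}` is a combination of lowering vectors**:
`P e_{B_j} = -∑_m e^{-iq_mj} e^{-iq_m/2}/(2N) · w_{q_m}` (`b_q = (w'_q - w_q)/(2e^{iq/2})`). [cite: LiebSchultzMattisAP1961, §II.C] -/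
theorem tfiPol_single_inr (j : Fin N) :
    tfiPol N (Pi.single (Sum.inr j) 1) =
      ∑ m : Fin N, (-(starRingEnd ℂ (ph (apMom N m) j) * (halfPh (apMom N m))⁻¹) / (2 * N)) • tfiLow N (apMom N m) := by
  have hN : (N : ℂ) ≠ 0 := Nat.cast_ne_zero.2 (NeZero.ne N)
  funext c
  rw [Finset.sum_apply]
  rcases c with k | k
  · rw [tfiPol_single_inr_inl, tfiKerB, mul_sum]
    refine sum_congr rfl fun m _ => ?_
    simp only [Pi.smul_apply, smul_eq_mul, tfiLow_inl]
    field_simp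
  · rw [tfiPol_single_inr_inr, ← sum_conj_ph_mul_ph_div]
    refine sum_congr rfl fun m _ => ?_
    have hh := halfPh_ne_zero (apMom N m)
    simp only [Pi.smul_apply, smul_eq_mul, tfiLow_inr]
    field_simp

/-- The complementary part of `e_{A_j}` is a combination of RAISING vectors:
`e_{A_j} - P e_{A_j} = ∑_m e^{-iq_mj}/(2N) · w'_{q_m}`. [cite: LiebSchultzMattisAP1961, §II.C] -/
theorem single_inl_sub_tfiPol (j : Fin N) :
    Pi.single (Sum.inl j) (1 : ℂ) - tfiPol N (Pi.single (Sum.inl j) 1) =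
      ∑ m : Fin N, (starRingEnd ℂ (ph (apMom N m) j) / (2 * N)) • tfiHigh N (apMom N m) := by
  have hN : (N : ℂ) ≠ 0 := Nat.cast_ne_zero.2 (NeZero.ne N)
  funext c
  rw [Pi.sub_apply, Finset.sum_apply]
  rcases c with k | k
  · rw [tfiPol_single_inl_inl, Pi.single_apply]
    have h1 : (if (Sum.inl k : Fin N ⊕ Fin N) = Sum.inl j then (1 : ℂ) else 0) - (if j = k then 1 / 2 else 0) =
        if j = k then 1 / 2 else 0 := by
      by_cases hjk : j = k
      · subst hjk; simp; norm_num
      · rw [if_neg (fun h => hjk (Sum.inl_injective h).symm), if_neg hjk, sub_zero]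
    rw [h1, ← sum_conj_ph_mul_ph_div]
    refine sum_congr rfl fun m _ => ?_
    simp only [Pi.smul_apply, smul_eq_mul, tfiHigh_inl]
    ring
  · rw [tfiPol_single_inl_inr, Pi.single_apply, if_neg Sum.inr_ne_inl, zero_sub, tfiKerA, ← neg_mul, mul_sum]
    refine sum_congr rfl fun m _ => ?_
    simp only [Pi.smul_apply, smul_eq_mul, tfiHigh_inr]
    field_simp

/-- The complementary part of `e_{B_j}`:
`e_{B_j} - P e_{B_j} = ∑_m e^{-iq_mj} e^{-iq_m/2}/(2N) · w'_{q_m}`. [cite: LiebSchultzMattisAP1961, §II.C] -/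
theorem single_inr_sub_tfiPol (j : Fin N) :
    Pi.single (Sum.inr j) (1 : ℂ) - tfiPol N (Pi.single (Sum.inr j) 1) =
      ∑ m : Fin N, ((starRingEnd ℂ (ph (apMom N m) j) * (halfPh (apMom N m))⁻¹) / (2 * N)) • tfiHigh N (apMom N m) := by
  have hN : (N : ℂ) ≠ 0 := Nat.cast_ne_zero.2 (NeZero.ne N)
  funext c
  rw [Pi.sub_apply, Finset.sum_apply]
  rcases c with k | k
  · rw [tfiPol_single_inr_inl, Pi.single_apply, if_neg Sum.inl_ne_inr, zero_sub, tfiKerB, ← neg_mul, mul_sum]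
    refine sum_congr rfl fun m _ => ?_
    simp only [Pi.smul_apply, smul_eq_mul, tfiHigh_inl]
    field_simp
  · rw [tfiPol_single_inr_inr, Pi.single_apply]
    have h1 : (if (Sum.inr k : Fin N ⊕ Fin N) = Sum.inr j then (1 : ℂ) else 0) - (if j = k then 1 / 2 else 0) =
        if j = k then 1 / 2 else 0 := by
      by_cases hjk : j = k
      · subst hjk; simp; norm_num
      · rw [if_neg (fun h => hjk (Sum.inr_injective h).symm), if_neg hjk, sub_zero]
    rw [h1, ← sum_conj_ph_mul_ph_div]
    refine sum_congr rfl fun m _ => ?_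
    have hh := halfPh_ne_zero (apMom N m)
    simp only [Pi.smul_apply, smul_eq_mul, tfiHigh_inr]
    field_simp

variable (N) in
/-- **The lowering space** `W = span_ℂ {w_{q_m} : m < N}`: the coefficient vectors of the operators
`Γ(w_{q_m})` that must annihilate the ground state (LSM 1961, §II.B–C; Pfeuty 1970, §2: the
`η_k` with `η_k |Ψ₀⟩ = 0`). [cite: LiebSchultzMattisAP1961, §II.C] -/
def tfiLowSpace : Submodule ℂ (Fin N ⊕ Fin N → ℂ) :=
  Submodule.span ℂ (Set.range fun m : Fin N => tfiLow N (apMom N m))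

omit [NeZero N] in
/-- Each `w_{q_m}` is in the lowering space. [folklore] -/
theorem tfiLow_mem_tfiLowSpace (m : Fin N) : tfiLow N (apMom N m) ∈ tfiLowSpace N :=
  Submodule.subset_span ⟨m, rfl⟩

/-- `P e_c ∈ W` for every basis vector. [folklore] -/
theorem tfiPol_single_mem (c : Fin N ⊕ Fin N) : tfiPol N (Pi.single c 1) ∈ tfiLowSpace N := by
  rcases c with j | j
  · rw [tfiPol_single_inl]
    exact Submodule.sum_mem _ fun m _ => Submodule.smul_mem _ _ (tfiLow_mem_tfiLowSpace m)
  · rw [tfiPol_single_inr]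
    exact Submodule.sum_mem _ fun m _ => Submodule.smul_mem _ _ (tfiLow_mem_tfiLowSpace m)

/-- **First Fock property**: `P u ∈ W` for every `u`. [cite: LiebSchultzMattisAP1961, §II.C] -/
theorem tfiPol_mem (u : Fin N ⊕ Fin N → ℂ) : tfiPol N u ∈ tfiLowSpace N := by
  rw [pi_eq_sum_univ' u, map_sum]
  refine Submodule.sum_mem _ fun c _ => ?_
  rw [map_smul]
  exact Submodule.smul_mem _ _ (tfiPol_single_mem c)

/-- `conj (e_c - P e_c) ∈ W` for every basis vector (through `conj w'_{q_m} = w_{q_{rev m}}`). [folklore] -/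
theorem star_single_sub_tfiPol_mem (c : Fin N ⊕ Fin N) :
    star (Pi.single c (1 : ℂ) - tfiPol N (Pi.single c 1)) ∈ tfiLowSpace N := by
  rcases c with j | j
  · rw [single_inl_sub_tfiPol, star_sum]
    refine Submodule.sum_mem _ fun m _ => ?_
    rw [star_smul, star_tfiHigh_apMom]
    exact Submodule.smul_mem _ _ (tfiLow_mem_tfiLowSpace _)
  · rw [single_inr_sub_tfiPol, star_sum]
    refine Submodule.sum_mem _ fun m _ => ?_
    rw [star_smul, star_tfiHigh_apMom]
    exact Submodule.smul_mem _ _ (tfiLow_mem_tfiLowSpace _)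

/-- **Second Fock property**: `conj (u - P u) ∈ W` for every `u`. [cite: LiebSchultzMattisAP1961, §II.C] -/
theorem star_sub_tfiPol_mem (u : Fin N ⊕ Fin N → ℂ) : star (u - tfiPol N u) ∈ tfiLowSpace N := by
  have hu : u - tfiPol N u = ∑ c, u c • (Pi.single c (1 : ℂ) - tfiPol N (Pi.single c 1)) := by
    conv_lhs => rw [pi_eq_sum_univ' u]
    rw [map_sum, ← Finset.sum_sub_distrib]
    refine sum_congr rfl fun c _ => ?_
    rw [map_smul, smul_sub]
  rw [hu, star_sum]
  refine Submodule.sum_mem _ fun c _ => ?_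
  rw [star_smul]
  exact Submodule.smul_mem _ _ (star_single_sub_tfiPol_mem c)

/-! ### The contractions -/

omit [NeZero N] in
/-- **`⟨B_iB_j⟩ = δ_{ij}`**: `2 (P e_{B_i})_{B_j} = δ_{ij}`. [cite: LiebSchultzMattisAP1961, §II.C] -/
theorem two_mul_tfiPol_single_inr_inr (i j : Fin N) :
    2 * tfiPol N (Pi.single (Sum.inr i) 1) (Sum.inr j) = if i = j then 1 else 0 := by
  rw [tfiPol_single_inr_inr]
  split_ifs <;> norm_num

omit [NeZero N] in
/-- The `B`–`B` contractions vanish off the diagonal (the hypothesis of the determinant form of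
Wick's theorem, `expect_prodPairs`). [cite: LiebSchultzMattisAP1961, §II.C] -/
theorem tfiPol_single_inr_inr_of_ne {i j : Fin N} (hij : i ≠ j) :
    tfiPol N (Pi.single (Sum.inr i) 1) (Sum.inr j) = 0 := by
  rw [tfiPol_single_inr_inr, if_neg hij]

omit [NeZero N] in
/-- **The basic contraction of the critical chain**:
`G_N(i, j) = ⟨B_iA_j⟩ = 2 (P e_{B_i})_{A_j} = -N⁻¹ ∑_m e^{iq_m(j-i)} e^{-iq_m/2}` — a function of
`j - i`, the finite-`N` kernel over the antiperiodic momenta (in closed form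
`-i/(N sin(π(2(j-i)-1)/(2N)))`; as `N → ∞` it tends to `2i/(π(2(i-j)+1))`, a Cauchy kernel). [cite: PfeutyAnnPhys1970, §2 (the contraction G_r at λ = 1)] -/
theorem two_mul_tfiPol_single_inr_inl (i j : Fin N) :
    2 * tfiPol N (Pi.single (Sum.inr i) 1) (Sum.inl j) =
      -((N : ℂ)⁻¹ * ∑ m : Fin N, starRingEnd ℂ (ph (apMom N m) i) * ph (apMom N m) j * (halfPh (apMom N m))⁻¹) := by
  rw [tfiPol_single_inr_inl, tfiKerB, mul_left_comm, mul_sum, ← mul_neg, ← sum_neg_distrib]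
  congr 1
  refine sum_congr rfl fun m _ => ?_
  ring

end Polarization

end Literature.Probability.LatticeModels
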